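import Summits.QuantumFields.YangMills.Theorems.BalabanUVNodesN15KingModelAnalyticWindow
import Summits.QuantumFields.YangMills.Theorems.BalabanUVNodesN15KingModelComplexLinkHolomorphy
import HarnessLib

/-!
# BalabanUVNodes ∕ N15 — THE KING-MODEL RUNG (PART Ϩ-h): HOLOMORPHY OF THE FULL BACKGROUND PROPAGATOR IN THE LINK FIELD — `(U,V) ↦ A(U,V)` is ANALYTIC (polynomial: the transports are
# products of bond variables along the tree contours), `(U,V) ↦ G(U,V) = A(U,V)⁻¹` is analytic on the (open) invertibility locus, and PRINT's ONE-VARIABLE MAP `U ↦ G(U,U⁻¹)` — the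
# `Gᶜ`-continuation of `U ↦ (−cΔ_U + m² + aQ(U)^*Q(U))⁻¹` — is HOLOMORPHIC ON THE WHOLE POLYDISC `‖U_b − U₀_b‖ < s₀(κ,a,d)∕L` around every unitary `κ`-coercive `U₀` (PART Ϩ-g's radius),
# together with every fibre block and every entry: [B9] Thm 3.4's «extend … as analytic functions» on Bałaban's scale, in King's one-level model
# (Track A, DAG node N15 = NE2; FAN-OUT v1.1 §N15 s3 «KING-MODEL RUNG … + what the curved case adds»; count-neutral)

HONEST FRAMING.  Count-neutral (cell `pub-ymgap`, seat `pub-ymgap-dag-n15-e` g51; `--supports stmt-QuantumFields-27247 --as helper` = K3ᴬ, KEY MAP v3).  Mathlib analyticity over `𝕜`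
(holomorphy for `𝕜 = ℂ`) on the finite-dimensional space PART Ϛ-i `CxLinks` of two-sided link fields and on the space of one-sided fields; the invertibility input is PART Ϩ-g.  NOT
Bałaban's multi-level `G_k(U)`; NOT a node discharge (N15 of record untouched); nothing continuum ∕ ℝ⁴ ∕ OS ∕ Clay.

THE RESULTS (`K = fine L M`; `T` a tree contour system; any `a, c, m²`):
* §1 defs `evalFwdCLM`, `evalBwdCLM` (bond read-outs), `placedCLM` (Ϛ-a `placed` as a CLM); ★ `analyticAt_treeHol`, ★ `analyticAt_treeHolRev` (transports are analytic: products along the contour),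
  ★ `cxGram_eq_sum_placed` (`Q♯(V)Q(U) = Σ_{y,j,j′} E_{x_j x_{j′}}(L^{−2(d+1)}V(Γ_{x_j,y})U(Γ_{y,x_{j′}}))`), ★★ `analyticAt_cxGram`, ★★★ **`analyticAt_cxFullOp`** (`(U,V) ↦ A(U,V)` analytic EVERYWHERE),
  `continuous_cxFullOp`.
* §2 ★★★ **`analyticAt_cxFullOp_inv`** (analytic at every point of the invertibility locus), ★★ `isOpen_setOf_isUnit_cxFullOp`, `analyticOnNhd_cxFullOp_inv`, ★★ `analyticAt_blk_cxFullOp_inv`,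
  `analyticAt_cxFullOp_inv_entry`, `contDiffAt_cxFullOp_inv`; ★★ `analyticAt_cxFullOp_inv_unitary` (at `(U₀,U₀ᴴ)` for every unitary `κ`-coercive `U₀`, King's scaling).
* §3 PRINT's ONE-VARIABLE MAP: ★ `analyticAt_invLinks` (`U ↦ U⁻¹` bondwise, at bondwise-invertible fields), ★ `analyticAt_sliceEmbed` (`U ↦ (U,U⁻¹)`), ★★★★ **`analyticAt_printMap`** (`U ↦ G(U,U⁻¹)`
  analytic at every `U` of the closed polydisc `‖U_b − U₀_b‖ ≤ ε`, `Lε ≤ s₀(κ,a,d)`), ★★★★ **`analyticOnNhd_printMap_polydisc`** (analytic on the OPEN polydisc `‖U_b − U₀_b‖ < s₀∕L` — [B9] THM 3.4's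
  «extend to … as analytic functions» ON BAŁABAN's SCALE), ★★★ `analyticOnNhd_blk_printMap_polydisc` ∕ `analyticOnNhd_printMap_entry_polydisc` (every fibre block ∕ entry of the kernel is a holomorphic
  function of the link variables there), `printMap_at_unitary` (`= (A₀(U₀))⁻¹` at unitary points).
PRIOR TREE ART (by name): Ϛ-i (`CxLinks`, `analyticAt_cxLapF`, `cxBlkCLM`, `cxEntryCLM`), Ϛ-a (`placed_add'`, `placed_smul'`, `blk_placed'`, `blk_sum'`), Ϩ-a (`cxFullOp`, `treeHolRev`, `cxQadj`,
`blk_cxGram_site`, `cxFullOp_inv_of_unitary`), Ϩ-g (`sliceRadius`, `isUnit_cxFullOp_at_radius`), Ϩ-f (`isUnit_of_near_unitary`), Ͱ-c (`ext_of_blk`), Mathlib (`analyticAt_inverse`, `AnalyticAt.mul∕smul∕prod∕pi∕comp`,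
`Finset.analyticAt_sum`, `ContinuousLinearMap.proj`, `Units.isOpen`).  Dedup (rg at filing): basename 0 files; needles `analyticAt_cxFullOp|printMap|analyticAt_treeHol|placedCLM` 0 tree files.
presearch: n/a (Mathlib analytic-function API).  Locators: [Balaban1985BackgroundPropagators] §3.B p.399 l.37–40, Thm 3.4 p.400, (3.50)–(3.53) p.400; [King1986] (2.13) p.653.  0 `sorry`, 3 `def`.
-/

noncomputable section
open scoped BigOperators ComplexConjugate ComplexOrder Topology Matrix.Norms.L2Operator
open Finset Matrix WithLp

namespace Summit.QuantumFields.YangMills.BalabanUVNodes.N15KingModelRung.Analytic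

open Literature.MathematicalPhysics.QuantumFieldTheory.LatticeDiamagneticInequality (blk placed)
open Literature.MathematicalPhysics.QuantumFieldTheory.Balaban1983to89.B5Prop11Plancherel (Tor fine unitVec)
open Literature.MathematicalPhysics.QuantumFieldTheory.King1986.Torus (site site_injective blockOf blockOf_site blockEquiv blockEquiv_apply)
open Summit.QuantumFields.YangMills.BalabanUVNodes.N15KingModelRung.Covariant
  (cxLapF CxLinks analyticAt_cxLapF cxBlkCLM cxEntryCLM ext_of_blk placed_add' placed_smul' blk_placed' blk_sum' blk_smul' fib)
open Summit.QuantumFields.YangMills.BalabanUVNodes.N15KingModelRung.CovariantBlock (BlockTree treeHol treeHol_root treeHol_of_ne_root covQ fullOpU)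
open Summit.QuantumFields.YangMills.BalabanUVNodes.N15KingModelRung.CombesThomas (ctRate)

variable {d : ℕ} {L : ℕ} [NeZero L] (T : BlockTree d L) (M : Fin (d + 1) → ℕ) [hM : ∀ μ, NeZero (M μ)]
variable {𝕜 : Type*} [RCLike 𝕜] {n : Type*} [Fintype n] [DecidableEq n]

/-! ## §1 `(U,V) ↦ A(U,V)` is analytic everywhere -/

section Polynomial

variable (𝕜 n) in
/-- The read-out of the forward variable on one bond, as a CLM on the space of two-sided fields. [folklore] -/
def evalFwdCLM (b : Tor (fine L M) × Fin (d + 1)) : CxLinks (fine L M) 𝕜 n →L[𝕜] Matrix n n 𝕜 :=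
  (ContinuousLinearMap.proj b).comp (ContinuousLinearMap.fst 𝕜 _ _)

variable (𝕜 n) in
/-- The read-out of the backward variable on one bond. [folklore] -/
def evalBwdCLM (b : Tor (fine L M) × Fin (d + 1)) : CxLinks (fine L M) 𝕜 n →L[𝕜] Matrix n n 𝕜 :=
  (ContinuousLinearMap.proj b).comp (ContinuousLinearMap.snd 𝕜 _ _)

variable (𝕜 n) in
/-- Ϛ-a's block placement `A ↦ E_{xy}(A)` as a CLM. [folklore] -/
def placedCLM (x y : Tor (fine L M)) : Matrix n n 𝕜 →L[𝕜] Matrix (Tor (fine L M) × n) (Tor (fine L M) × n) 𝕜 :=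
  LinearMap.toContinuousLinearMap
    { toFun := fun A => placed x y A
      map_add' := fun A B => placed_add' (fine L M) x y A B
      map_smul' := fun r A => by rw [RingHom.id_apply]; exact placed_smul' (fine L M) x y r A }

/-- ★ THE TRANSPORTS ARE ANALYTIC: `(U,V) ↦ U(Γ_{y,x_j})` is analytic everywhere (a product of bond read-outs along the contour). [cite: Balaban1985BackgroundPropagators, §3.B p.399 l.37–40, (3.19) p.393] -/
theorem analyticAt_treeHol (b : Tor M) (UV₀ : CxLinks (fine L M) 𝕜 n) : ∀ j, AnalyticAt 𝕜 (fun UV : CxLinks (fine L M) 𝕜 n => treeHol M T UV.1 b j) UV₀ := by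
  refine T.induction (P := fun j => AnalyticAt 𝕜 (fun UV : CxLinks (fine L M) 𝕜 n => treeHol M T UV.1 b j) UV₀) ?_ fun j hj ih => ?_
  · simp_rw [treeHol_root]; exact analyticAt_const
  · simp_rw [treeHol_of_ne_root T M _ b hj]
    have h2 : AnalyticAt 𝕜 (fun UV : CxLinks (fine L M) 𝕜 n => UV.1 (site L M b (T.parent j), T.axis j)) UV₀ :=
      (evalFwdCLM M 𝕜 n (site L M b (T.parent j), T.axis j)).analyticAt UV₀
    exact ih.mul h2

/-- ★ THE REVERSED TRANSPORTS ARE ANALYTIC: `(U,V) ↦ V(Γ_{x_j,y})`. [cite: Balaban1985BackgroundPropagators, §3.B p.399 l.37–40, (3.19) p.393] -/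
theorem analyticAt_treeHolRev (b : Tor M) (UV₀ : CxLinks (fine L M) 𝕜 n) : ∀ j, AnalyticAt 𝕜 (fun UV : CxLinks (fine L M) 𝕜 n => treeHolRev M T UV.2 b j) UV₀ := by
  refine T.induction (P := fun j => AnalyticAt 𝕜 (fun UV : CxLinks (fine L M) 𝕜 n => treeHolRev M T UV.2 b j) UV₀) ?_ fun j hj ih => ?_
  · simp_rw [treeHolRev_root]; exact analyticAt_const
  · simp_rw [treeHolRev_of_ne_root T M _ b hj]
    have h2 : AnalyticAt 𝕜 (fun UV : CxLinks (fine L M) 𝕜 n => UV.2 (site L M b (T.parent j), T.axis j)) UV₀ :=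
      (evalBwdCLM M 𝕜 n (site L M b (T.parent j), T.axis j)).analyticAt UV₀
    exact h2.mul ih

/-- ★ THE GRAM TERM AS A SUM OF PLACED BLOCKS: `Q♯(V)Q(U) = Σ_y Σ_j Σ_{j′} E_{site y j, site y j′}(L^{−2(d+1)}·V(Γ_{x_j,y})U(Γ_{y,x_{j′}}))`. [cite: Balaban1985BackgroundPropagators, (3.19) p.393, (3.24) p.394] -/
theorem cxGram_eq_sum_placed (U V : Tor (fine L M) × Fin (d + 1) → Matrix n n 𝕜) :
    cxQadj T M V * covQ T M U
      = ∑ y : Tor M, ∑ j : Fin (d + 1) → Fin L, ∑ j' : Fin (d + 1) → Fin L,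
          placed (site L M y j) (site L M y j') (((((L : ℝ) ^ (d + 1))⁻¹ ^ 2 : ℝ) : 𝕜) • (treeHolRev M T V y j * treeHol M T U y j')) := by
  refine ext_of_blk (fine L M) fun x x' => ?_
  obtain ⟨⟨β, j₀⟩, rfl⟩ := (blockEquiv L M).surjective x
  obtain ⟨⟨β', j₀'⟩, rfl⟩ := (blockEquiv L M).surjective x'
  simp only [blockEquiv_apply]
  rw [blk_cxGram_site, blk_sum']
  simp_rw [blk_sum', blk_placed']
  have hinj : ∀ y j, (site L M y j = site L M β j₀) ↔ (y = β ∧ j = j₀) := fun y j =>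
    ⟨fun h => by have := site_injective L M (a₁ := (y, j)) (a₂ := (β, j₀)) h; exact ⟨(Prod.mk.inj this).1, (Prod.mk.inj this).2⟩, fun h => by rw [h.1, h.2]⟩
  have hinj' : ∀ y j', (site L M y j' = site L M β' j₀') ↔ (y = β' ∧ j' = j₀') := fun y j' =>
    ⟨fun h => by have := site_injective L M (a₁ := (y, j')) (a₂ := (β', j₀')) h; exact ⟨(Prod.mk.inj this).1, (Prod.mk.inj this).2⟩, fun h => by rw [h.1, h.2]⟩
  rw [Finset.sum_eq_single β]
  · rw [Finset.sum_eq_single j₀]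
    · rw [Finset.sum_eq_single j₀']
      · by_cases h : β = β'
        · subst h; simp only [and_self, if_true]
        · rw [if_neg h, if_neg]; rintro ⟨_, h2⟩; exact h ((hinj' β j₀').1 h2).1
      · intro j' _ hj'; rw [if_neg]; rintro ⟨_, h2⟩; exact hj' ((hinj' β j').1 h2).2
      · intro h; exact absurd (Finset.mem_univ _) h
    · intro j _ hj; refine Finset.sum_eq_zero fun j' _ => ?_; rw [if_neg]; rintro ⟨h1, _⟩; exact hj ((hinj β j).1 h1).2
    · intro h; exact absurd (Finset.mem_univ _) h
  · intro y _ hy; refine Finset.sum_eq_zero fun j _ => Finset.sum_eq_zero fun j' _ => ?_; rw [if_neg]; rintro ⟨h1, _⟩; exact hy ((hinj y j).1 h1).1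
  · intro h; exact absurd (Finset.mem_univ _) h

/-- ★★ **THE COMPLEXIFIED BLOCK TERM IS ANALYTIC EVERYWHERE** in the two-sided field. [cite: Balaban1985BackgroundPropagators, §3.B p.399 l.37–40, (3.24) p.394] -/
theorem analyticAt_cxGram (UV₀ : CxLinks (fine L M) 𝕜 n) : AnalyticAt 𝕜 (fun UV : CxLinks (fine L M) 𝕜 n => cxQadj T M UV.2 * covQ T M UV.1) UV₀ := by
  simp_rw [cxGram_eq_sum_placed]
  refine Finset.analyticAt_fun_sum _ fun y _ => Finset.analyticAt_fun_sum _ fun j _ => Finset.analyticAt_fun_sum _ fun j' _ => ?_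
  have e : (fun UV : CxLinks (fine L M) 𝕜 n => ((((L : ℝ) ^ (d + 1))⁻¹ ^ 2 : ℝ) : 𝕜) • (treeHolRev M T UV.2 y j * treeHol M T UV.1 y j'))
      = ((((L : ℝ) ^ (d + 1))⁻¹ ^ 2 : ℝ) : 𝕜) • ((fun UV : CxLinks (fine L M) 𝕜 n => treeHolRev M T UV.2 y j) * fun UV => treeHol M T UV.1 y j') := rfl
  have h : AnalyticAt 𝕜 (fun UV : CxLinks (fine L M) 𝕜 n => ((((L : ℝ) ^ (d + 1))⁻¹ ^ 2 : ℝ) : 𝕜) • (treeHolRev M T UV.2 y j * treeHol M T UV.1 y j')) UV₀ := by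
    rw [e]; exact ((analyticAt_treeHolRev T M y UV₀ j).mul (analyticAt_treeHol T M y UV₀ j')).const_smul
  exact ((placedCLM M 𝕜 n (site L M y j) (site L M y j')).analyticAt _).comp h

/-- ★★★ **`(U,V) ↦ A(U,V)` IS ANALYTIC EVERYWHERE** (affine hopping part, Ϛ-i, plus the polynomial block term). [cite: Balaban1985BackgroundPropagators, §3.B p.399 l.37–40, Thm 3.4 p.400] -/
theorem analyticAt_cxFullOp (a c m2 : ℝ) (UV₀ : CxLinks (fine L M) 𝕜 n) : AnalyticAt 𝕜 (fun UV : CxLinks (fine L M) 𝕜 n => cxFullOp T M a c m2 UV.1 UV.2) UV₀ := by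
  unfold cxFullOp
  have e : (fun UV : CxLinks (fine L M) 𝕜 n => ((a * (L : ℝ) ^ (d + 1) : ℝ) : 𝕜) • (cxQadj T M UV.2 * covQ T M UV.1))
      = ((a * (L : ℝ) ^ (d + 1) : ℝ) : 𝕜) • (fun UV : CxLinks (fine L M) 𝕜 n => cxQadj T M UV.2 * covQ T M UV.1) := rfl
  have h : AnalyticAt 𝕜 (fun UV : CxLinks (fine L M) 𝕜 n => ((a * (L : ℝ) ^ (d + 1) : ℝ) : 𝕜) • (cxQadj T M UV.2 * covQ T M UV.1)) UV₀ := by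
    rw [e]; exact (analyticAt_cxGram T M UV₀).const_smul
  exact (analyticAt_cxLapF (fine L M) c m2 UV₀).add h

/-- `(U,V) ↦ A(U,V)` is continuous. [folklore] -/
theorem continuous_cxFullOp (a c m2 : ℝ) : Continuous (fun UV : CxLinks (fine L M) 𝕜 n => cxFullOp T M a c m2 UV.1 UV.2) :=
  continuous_iff_continuousAt.2 fun UV => (analyticAt_cxFullOp T M a c m2 UV).continuousAt

end Polynomial

/-! ## §2 `(U,V) ↦ G(U,V)` is analytic on the invertibility locus -/

section Locus

/-- `G(U,V) = A(U,V)⁻¹` is `Ring.inverse` of the polynomial map. [folklore] -/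
theorem cxFullOp_inv_eq_ringInverse_comp (a c m2 : ℝ) :
    (fun UV : CxLinks (fine L M) 𝕜 n => (cxFullOp T M a c m2 UV.1 UV.2)⁻¹) = Ring.inverse ∘ (fun UV : CxLinks (fine L M) 𝕜 n => cxFullOp T M a c m2 UV.1 UV.2) := by
  funext UV; exact Matrix.nonsing_inv_eq_ringInverse _

/-- ★★★ **HOLOMORPHY OF THE FULL PROPAGATOR IN THE TWO-SIDED FIELD**: `(U,V) ↦ G(U,V)` is analytic at every point where `A(U,V)` is invertible.
[cite: Balaban1985BackgroundPropagators, Thm 3.4 p.400, §3.B p.399 l.37–40] -/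
theorem analyticAt_cxFullOp_inv {a c m2 : ℝ} {UV₀ : CxLinks (fine L M) 𝕜 n} (hU : IsUnit (cxFullOp T M a c m2 UV₀.1 UV₀.2)) :
    AnalyticAt 𝕜 (fun UV : CxLinks (fine L M) 𝕜 n => (cxFullOp T M a c m2 UV.1 UV.2)⁻¹) UV₀ := by
  haveI : CompleteSpace (Matrix (Tor (fine L M) × n) (Tor (fine L M) × n) 𝕜) := FiniteDimensional.complete 𝕜 _
  rw [cxFullOp_inv_eq_ringInverse_comp]
  exact (analyticAt_inverse (𝕜 := 𝕜) hU.unit).comp_of_eq (analyticAt_cxFullOp T M a c m2 UV₀) hU.unit_spec.symm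

/-- ★★ THE INVERTIBILITY LOCUS IS OPEN. [cite: Balaban1985BackgroundPropagators, §3.B p.399 l.40 – p.400 l.3] -/
theorem isOpen_setOf_isUnit_cxFullOp (a c m2 : ℝ) : IsOpen {UV : CxLinks (fine L M) 𝕜 n | IsUnit (cxFullOp T M a c m2 UV.1 UV.2)} := by
  haveI : CompleteSpace (Matrix (Tor (fine L M) × n) (Tor (fine L M) × n) 𝕜) := FiniteDimensional.complete 𝕜 _
  exact (Units.isOpen (R := Matrix (Tor (fine L M) × n) (Tor (fine L M) × n) 𝕜)).preimage (continuous_cxFullOp T M a c m2)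

/-- `G` is analytic on the (open) invertibility locus. [cite: Balaban1985BackgroundPropagators, Thm 3.4 p.400] -/
theorem analyticOnNhd_cxFullOp_inv (a c m2 : ℝ) :
    AnalyticOnNhd 𝕜 (fun UV : CxLinks (fine L M) 𝕜 n => (cxFullOp T M a c m2 UV.1 UV.2)⁻¹) {UV | IsUnit (cxFullOp T M a c m2 UV.1 UV.2)} :=
  fun _ hUV => analyticAt_cxFullOp_inv T M hUV

/-- ★★ THE FIBRE BLOCKS `(U,V) ↦ blk G(U,V) x y` are analytic on the locus. [cite: Balaban1985BackgroundPropagators, Thm 3.4 p.400] -/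
theorem analyticAt_blk_cxFullOp_inv {a c m2 : ℝ} {UV₀ : CxLinks (fine L M) 𝕜 n} (hU : IsUnit (cxFullOp T M a c m2 UV₀.1 UV₀.2)) (x y : Tor (fine L M)) :
    AnalyticAt 𝕜 (fun UV : CxLinks (fine L M) 𝕜 n => blk (cxFullOp T M a c m2 UV.1 UV.2)⁻¹ x y) UV₀ :=
  ((cxBlkCLM (fine L M) 𝕜 n x y).analyticAt _).comp (analyticAt_cxFullOp_inv T M hU)

/-- ★★ THE ENTRIES `(U,V) ↦ G(U,V)(p,q)` are analytic (scalar holomorphic functions of the link variables) on the locus. [cite: Balaban1985BackgroundPropagators, Thm 3.4 p.400] -/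
theorem analyticAt_cxFullOp_inv_entry {a c m2 : ℝ} {UV₀ : CxLinks (fine L M) 𝕜 n} (hU : IsUnit (cxFullOp T M a c m2 UV₀.1 UV₀.2)) (p q : Tor (fine L M) × n) :
    AnalyticAt 𝕜 (fun UV : CxLinks (fine L M) 𝕜 n => (cxFullOp T M a c m2 UV.1 UV.2)⁻¹ p q) UV₀ :=
  ((cxEntryCLM (fine L M) 𝕜 p q).analyticAt _).comp (analyticAt_cxFullOp_inv T M hU)

/-- `G` is smooth at every point of the locus. [folklore] -/
theorem contDiffAt_cxFullOp_inv {a c m2 : ℝ} {UV₀ : CxLinks (fine L M) 𝕜 n} (hU : IsUnit (cxFullOp T M a c m2 UV₀.1 UV₀.2)) {m : WithTop ℕ∞} :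
    ContDiffAt 𝕜 m (fun UV : CxLinks (fine L M) 𝕜 n => (cxFullOp T M a c m2 UV.1 UV.2)⁻¹) UV₀ :=
  (analyticAt_cxFullOp_inv T M hU).contDiffAt

/-- ★★ **ANALYTIC AT EVERY UNITARY COERCIVE FIELD** (King's scaling, contours of depth `≤ (d+1)(L−1)`, `a, m² ≥ 0`, `L ≥ 1`): `(U,V) ↦ G(U,V)` is analytic at `(U₀,U₀ᴴ)` — the real slice through
which print complexifies; there `G(U₀,U₀ᴴ) = A₀(U₀)⁻¹`. [cite: Balaban1985BackgroundPropagators, §3.B p.399 l.37–40, Thm 3.4 p.400] -/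
theorem analyticAt_cxFullOp_inv_unitary (hD : ∀ j, T.depth j ≤ (d + 1) * (L - 1)) {a m2 : ℝ} (ha : 0 ≤ a) (hm : 0 ≤ m2) (hL : 1 ≤ L)
    {U₀ : Tor (fine L M) × Fin (d + 1) → Matrix n n 𝕜} (hU₀ : ∀ bd, U₀ bd ∈ Matrix.unitaryGroup n 𝕜) {κ : ℝ} (hκ : 0 < κ)
    (hcoer : ∀ v : Tor (fine L M) × n → 𝕜, κ * ∑ x, ‖fib (fine L M) v x‖ ^ 2 ≤ RCLike.re (star v ⬝ᵥ (fullOpU T M a ((L : ℝ) ^ 2) m2 U₀ *ᵥ v))) :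
    AnalyticAt 𝕜 (fun UV : CxLinks (fine L M) 𝕜 n => (cxFullOp T M a ((L : ℝ) ^ 2) m2 UV.1 UV.2)⁻¹) (U₀, fun bd => (U₀ bd)ᴴ) := by
  refine analyticAt_cxFullOp_inv T M ?_
  have hinv : (fun bd => (U₀ bd)⁻¹) = fun bd => (U₀ bd)ᴴ := by
    funext bd
    have h1 : (U₀ bd)ᴴ * U₀ bd = 1 := by simpa only [star_eq_conjTranspose] using Matrix.mem_unitaryGroup_iff'.mp (hU₀ bd)
    exact Matrix.inv_eq_left_inv h1
  have h := isUnit_cxFullOp_at_radius T M hD ha hm hL hU₀ hκ hcoer (ε := 0) le_rfl (U := U₀) (fun bd => by rw [sub_self, norm_zero])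
    (by rw [mul_zero]; exact (sliceRadius_pos hκ ha d).le)
  simp only [hinv] at h
  exact h

end Locus

/-! ## §3 Print's one-variable map `U ↦ G(U,U⁻¹)` on the polydisc -/

section Print

/-- ★ `U ↦ U⁻¹` (bondwise matrix inverse) is analytic at every bondwise-invertible field. [cite: Balaban1985BackgroundPropagators, §3.B p.399 l.37–40] -/
theorem analyticAt_invLinks {U₀ : Tor (fine L M) × Fin (d + 1) → Matrix n n 𝕜} (hU₀ : ∀ bd, IsUnit (U₀ bd)) :
    AnalyticAt 𝕜 (fun U : Tor (fine L M) × Fin (d + 1) → Matrix n n 𝕜 => fun bd => (U bd)⁻¹) U₀ := by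
  haveI : CompleteSpace (Matrix n n 𝕜) := FiniteDimensional.complete 𝕜 _
  refine AnalyticAt.pi fun bd => ?_
  have hfun : (fun U : Tor (fine L M) × Fin (d + 1) → Matrix n n 𝕜 => (U bd)⁻¹) = Ring.inverse ∘ (fun U : Tor (fine L M) × Fin (d + 1) → Matrix n n 𝕜 => U bd) := by
    funext U; exact Matrix.nonsing_inv_eq_ringInverse _
  rw [hfun]
  exact (analyticAt_inverse (𝕜 := 𝕜) (hU₀ bd).unit).comp_of_eq ((ContinuousLinearMap.proj (R := 𝕜) bd).analyticAt U₀) (hU₀ bd).unit_spec.symm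

/-- ★ THE SLICE EMBEDDING `U ↦ (U, U⁻¹)` is analytic at every bondwise-invertible field. [cite: Balaban1985BackgroundPropagators, §3.B p.399 l.37–40] -/
theorem analyticAt_sliceEmbed {U₀ : Tor (fine L M) × Fin (d + 1) → Matrix n n 𝕜} (hU₀ : ∀ bd, IsUnit (U₀ bd)) :
    AnalyticAt 𝕜 (fun U : Tor (fine L M) × Fin (d + 1) → Matrix n n 𝕜 => ((U, fun bd => (U bd)⁻¹) : CxLinks (fine L M) 𝕜 n)) U₀ :=
  analyticAt_id.prod (analyticAt_invLinks M hU₀)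

variable (hD : ∀ j, T.depth j ≤ (d + 1) * (L - 1)) {a m2 : ℝ} (ha : 0 ≤ a) (hm : 0 ≤ m2) (hL : 1 ≤ L)
variable {U₀ : Tor (fine L M) × Fin (d + 1) → Matrix n n 𝕜} (hU₀ : ∀ bd, U₀ bd ∈ Matrix.unitaryGroup n 𝕜) {κ : ℝ} (hκ : 0 < κ)
  (hcoer : ∀ v : Tor (fine L M) × n → 𝕜, κ * ∑ x, ‖fib (fine L M) v x‖ ^ 2 ≤ RCLike.re (star v ⬝ᵥ (fullOpU T M a ((L : ℝ) ^ 2) m2 U₀ *ᵥ v)))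
include hD ha hm hL hU₀ hκ hcoer

/-- ★★★★ **PRINT's MAP `U ↦ G(U,U⁻¹)` IS ANALYTIC AT EVERY POINT OF THE CLOSED POLYDISC** `‖U_b − U₀_b‖ ≤ ε`, `Lε ≤ s₀(κ,a,d)`, around a unitary `κ`-coercive `U₀` (King's scaling).
[cite: Balaban1985BackgroundPropagators, Thm 3.4 p.400, §3.B p.399 l.37–40] -/
theorem analyticAt_printMap {U : Tor (fine L M) × Fin (d + 1) → Matrix n n 𝕜} {ε : ℝ} (hε0 : 0 ≤ ε) (hU : ∀ bd, ‖U bd - U₀ bd‖ ≤ ε) (hrad : (L : ℝ) * ε ≤ sliceRadius κ a d) :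
    AnalyticAt 𝕜 (fun W : Tor (fine L M) × Fin (d + 1) → Matrix n n 𝕜 => (cxFullOp T M a ((L : ℝ) ^ 2) m2 W (fun bd => (W bd)⁻¹))⁻¹) U := by
  have hε1 : ε < 1 := by
    have hL1 : (1 : ℝ) ≤ L := by exact_mod_cast hL
    have h := hrad.trans (sliceRadius_le κ a d).1
    have hd : (4 : ℝ) ≤ 4 * ((d : ℝ) + 1) := by have : (0 : ℝ) ≤ d := Nat.cast_nonneg d; linarith
    have h2 : (L : ℝ) * ε ≤ 1 / 4 := h.trans (one_div_le_one_div_of_le (by norm_num) hd)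
    nlinarith
  have hunit : ∀ bd, IsUnit (U bd) := fun bd => isUnit_of_near_unitary (hU₀ bd) (hU bd) hε1
  have hA : IsUnit (cxFullOp T M a ((L : ℝ) ^ 2) m2 U (fun bd => (U bd)⁻¹)) := isUnit_cxFullOp_at_radius T M hD ha hm hL hU₀ hκ hcoer hε0 hU hrad
  have h := (analyticAt_cxFullOp_inv T M (UV₀ := ((U, fun bd => (U bd)⁻¹) : CxLinks (fine L M) 𝕜 n)) hA).comp_of_eq (analyticAt_sliceEmbed M hunit) rfl
  exact h

/-- ★★★★ **[B9] THEOREM 3.4's «EXTEND … AS ANALYTIC FUNCTIONS», ON BAŁABAN's SCALE, IN KING's ONE-LEVEL MODEL**: print's map `U ↦ G(U,U⁻¹)` — the `Gᶜ`-continuation of the full background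
propagator `U ↦ (L²(−Δ_U) + m² + aQ(U)^*Q(U))⁻¹` off the unitary fields — is analytic on (a neighbourhood of every point of) the OPEN POLYDISC `‖U_b − U₀_b‖ < s₀(κ,a,d)∕L` around every unitary
`κ`-coercive `U₀`, for every `L ≥ 1`, volume, fibre, contour system of depth `≤ (d+1)(L−1)`. [cite: Balaban1985BackgroundPropagators, Thm 3.4 p.400, §3.B p.399 l.37–40] -/
theorem analyticOnNhd_printMap_polydisc :
    AnalyticOnNhd 𝕜 (fun W : Tor (fine L M) × Fin (d + 1) → Matrix n n 𝕜 => (cxFullOp T M a ((L : ℝ) ^ 2) m2 W (fun bd => (W bd)⁻¹))⁻¹)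
      {U | ∀ bd, ‖U bd - U₀ bd‖ < sliceRadius κ a d / L} := by
  intro U hU
  have hL0 : (0 : ℝ) < L := by exact_mod_cast hL
  exact analyticAt_printMap T M hD ha hm hL hU₀ hκ hcoer (div_nonneg (sliceRadius_pos hκ ha d).le hL0.le) (fun bd => (hU bd).le) (by rw [mul_div_cancel₀ _ hL0.ne'])

/-- ★★★ EVERY FIBRE BLOCK OF THE KERNEL `U ↦ blk G(U,U⁻¹) x y` IS A HOLOMORPHIC FUNCTION of the link variables on the polydisc. [cite: Balaban1985BackgroundPropagators, Thm 3.4 p.400] -/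
theorem analyticOnNhd_blk_printMap_polydisc (x y : Tor (fine L M)) :
    AnalyticOnNhd 𝕜 (fun W : Tor (fine L M) × Fin (d + 1) → Matrix n n 𝕜 => blk (cxFullOp T M a ((L : ℝ) ^ 2) m2 W (fun bd => (W bd)⁻¹))⁻¹ x y)
      {U | ∀ bd, ‖U bd - U₀ bd‖ < sliceRadius κ a d / L} :=
  fun U hU => ((cxBlkCLM (fine L M) 𝕜 n x y).analyticAt _).comp (analyticOnNhd_printMap_polydisc T M hD ha hm hL hU₀ hκ hcoer U hU)

/-- ★★★ EVERY ENTRY OF THE KERNEL IS A HOLOMORPHIC SCALAR FUNCTION of the link variables on the polydisc. [cite: Balaban1985BackgroundPropagators, Thm 3.4 p.400] -/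
theorem analyticOnNhd_printMap_entry_polydisc (p q : Tor (fine L M) × n) :
    AnalyticOnNhd 𝕜 (fun W : Tor (fine L M) × Fin (d + 1) → Matrix n n 𝕜 => (cxFullOp T M a ((L : ℝ) ^ 2) m2 W (fun bd => (W bd)⁻¹))⁻¹ p q)
      {U | ∀ bd, ‖U bd - U₀ bd‖ < sliceRadius κ a d / L} :=
  fun U hU => ((cxEntryCLM (fine L M) 𝕜 p q).analyticAt _).comp (analyticOnNhd_printMap_polydisc T M hD ha hm hL hU₀ hκ hcoer U hU)

omit hD ha hm hL hκ hcoer in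
/-- AT A UNITARY FIELD print's map is PART Ϥ-d's propagator: `G(U₀,U₀⁻¹) = A₀(U₀)⁻¹`. [cite: Balaban1985BackgroundPropagators, §3.B p.399 l.37–40] -/
theorem printMap_at_unitary : (cxFullOp T M a ((L : ℝ) ^ 2) m2 U₀ (fun bd => (U₀ bd)⁻¹))⁻¹ = (fullOpU T M a ((L : ℝ) ^ 2) m2 U₀)⁻¹ := by
  rw [cxFullOp_inv_of_unitary T M a _ m2 hU₀]

end Print

end Summit.QuantumFields.YangMills.BalabanUVNodes.N15KingModelRung.Analytic

end
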